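import Literature.NumberTheory.EllipticCurves.Kato2004.AdmissibleZetaClass
import Literature.NumberTheory.EllipticCurves.Kato2004.IwasawaH1RankLeOneProofs
import Literature.NumberTheory.EllipticCurves.IwasawaAlgebraCharIdealProofs
import HarnessLib

/-!
# Kato 2004 (Astérisque 295), Thm. 12.5 (1)(2) with §13.9 and Lemma 13.10 (1) ON ONE `Δ`-BRANCH, Thm. 12.4 (2)
# replaced by the hypothesis «`rank_Λ 𝐇¹ ≤ 1`»: the `Ω_W`-normalised zeta class `𝐳_{γ_W}` EXISTS in `𝐇¹_Γ(T_pW) ⊗ ℚ`,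
# is non-zero, and sits in ONE position with respect to EVERY value-pinned family realised in `𝐇¹_Γ(T_pW)` —
# two closed predicates (definitions with bodies), kernel bridges, ONE named fact, proved corollaries

Topic `NumberTheory/EllipticCurves`, sub-directory `Kato2004` (namespace = path).  Typed by seat `bsd-cm-prr-ty1` g27
(literature-prover, cell bsd-cm) on the planner's word **D872 (GENUS-LIT-3)** for crux `EllipticUnitValueSevenOfGZK`
= stmt-BirchSwinnertonDyer-19945 (road R2 of stub 2★ (ii); the ideator's audit `Cruxes/EllipticUnitValueSevenOfGZK/
E3primeAudit-g58.md` REV 1.1, §3–§4, is the reading of record).  Companion of `Kato2004/AdmissibleZetaClass.lean`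
(the closed predicate `IsAdmissibleZetaClass W p K hK I z₀`: «`z₀ ∈ I.H` is, up to `Λˣ`, Kato's `Ω_W`-normalised
`𝐳_{γ_W}`», whose position clause (A6′) this file re-uses VERBATIM) and of the two REALISABILITY facts
`AdmissibleZetaClassRealisability.lean` (F051: Thm. 12.5 (4) under (12.5.2)) / `AdmissibleZetaClassRealisabilityCM.lean`
(Prop. 15.21 at an unramified irreducible prime of a CM curve) — both of which conclude INTEGRALITY `𝐳_{γ_W} ∈ 𝐇¹_Γ`.
THIS file concludes LESS (membership in `𝐇¹_Γ ⊗ ℚ` and the position), from LESS (the branch form of Thm. 12.4 (2)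
only), for EVERY elliptic `W/ℚ` and odd `p` — in particular on the locus the two realisability facts do not reach
(`W[p]` reducible, e.g. the CM curves of conductor `49D²` at `p = 7`).  DEFINITIONS WITH BODIES (two `Prop`s over
instance binders + their closed forms), kernel lemmas, ONE named fact (`def … : Prop`, D-0014: nothing asserted, no
`_holds` here; net debt +1), proved corollaries; no `instance`, no notation, no `sorry`.  HONEST FRAMING: nothing about
Kato's Main Conjecture or BSD is asserted; no summit statement is touched; 19945 stays OPEN.

## The printed statements (K. Kato, Astérisque 295 (2004); `[p. N]` = printed page = store `paper:doi-10-24033-ast-639`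
## PDF page `N − 115`; re-read 2026-08-30: p0105–p0107, p0112, p0114–p0119)

* **Thm. 12.4 (2) [p. 221]** "`𝐇¹(T)` is a torsion free `Λ`-module, and `𝐇¹(T) ⊗ ℚ = 𝐇¹(V_{F_λ}(f))` is a free
  `Λ ⊗ ℚ`-module of rank 1."
* **Thm. 12.5 (1) [p. 221]** "There exists a unique `F_λ`-linear map `V_{F_λ}(f) → 𝐇¹(V_{F_λ}(f)); γ ↦ 𝐳_γ^{(p)}`
  having the following property: Let `r ∈ ℤ`, `1 ≤ r ≤ k − 1`, let `n ≥ 0`, and let `γ ∈ V_{F_λ}(f)`. Then the image of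
  `𝐳_γ^{(p)}` under … `exp*` … belongs to `S(f) ⊗_F ℚ(ζ_{p^n})`, and the map `x ⊗ y ↦ Σ_{σ ∈ G_n} χ(σ)σ(y)·per_f(x)^±` …
  sends the image of `𝐳_γ^{(p)}` to `(2πi)^{k−r−1}·L_{(p)}(f, χ, r)·γ^±" (`±` the sign of `χ(−1)(−1)^{k−r−1}`).
  **(2) [p. 221]** "Let `Z(f)` be the `Λ ⊗ ℚ`-submodule of `𝐇¹(V_{F_λ}(f))` generated by `𝐳_γ^{(p)}` for all
  `γ ∈ V_{F_λ}(f)`. Then `𝐇¹(V_{F_λ}(f))/Z(f)` is a torsion `Λ ⊗ ℚ`-module."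
* **Thm. 12.6 [p. 222]** "Let `T = V_{O_λ}(f)` (8.3). Let `Z` be the `Λ`-submodule of `𝐇¹(V_{O_λ}(f))` generated by
  the following elements ((8.1.3), (8.11)): (1) `(₍c,d₎z^{(p)}_{p^n}(f, k, j, a(A), prime(pA)))_{n≥1}` (`1 ≤ j ≤ k−1`,
  `a, A ∈ ℤ`, `A ≥ 1`, `(c, 6pA) = (d, 6pN) = 1`); (2) `(₍c,d₎z^{(p)}_{p^n}(f, k, j, α, prime(pN)))_{n≥1}` (`α ∈ SL₂(ℤ)`,
  `(cd, 6pN) = 1`, `c ≡ d ≡ 1 mod N`). Then `Z ⊂ Z(f, T)` and `Z(f, T)/Z` is a finite group."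
* **§13.9 [pp. 229–230]** "In this 13.9, we define the p-adic zeta element `z_γ^{(p)}` for `γ ∈ V_{F_λ}(f)` … first as
  an element of `𝐇¹(V_{F_λ}(f)) ⊗_Λ Q(Λ)`. We will see in 13.12 that `z_γ^{(p)}` belongs to `𝐇¹(V_{F_λ}(f))`. …
  [the definition: the integral `(c, d)`-classes divided by `μ(c, d, j)` and the symbol coordinates] … **Since
  `𝐇¹(V_{F_λ}(f))` is a free `Λ[1/p]`-module of rank 1 (Thm. 12.4 (2)), this shows that `z_γ^{(p)}` is independent of
  the choices** of `α_i, j_i, c, d` as above." [p0115 l. 8–9]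
* **Lemma 13.10 (1) [p. 230]** (the identity in `𝐇¹(V_{F_λ}(f)) ⊗_Λ Q(Λ)` expressing the integral `a(A)`-type class
  `₍c,d₎z^{(p)}(f, k, j, a(A), prime(pA))` as the four-cusp multiplier times the Euler factors `∏_{ℓ∣A} (…σ_ℓ⁻¹…)` times
  `z^{(p)}_{δ(f, j, a(A))}`); **proof [p. 230 l. 84]** "By Thm. 12.4 (2), this is obtained by computing the images … under
  (13.7.1) by using Thm. 6.6 and Thm. 9.7."
* **§13.12 [pp. 231–233]** (proof of 12.5 (1) and 12.6: `Z ⊂ Z(f, T)`, `Z(f, T)/Z` finite, `Z(f, T)_𝔭 = Z_𝔭` at every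
  height-one `𝔭 ∌ p`, via Thm. 13.5 (Rohrlich at `k = 2`), 13.11, (13.12.1)–(13.12.5)); **§13.13 [p. 233 l. 49]** "Thm. 12.5 (2)
  follows from Thm. 12.4 (2) and the fact that `Z(f)_q ≠ 0` …" (Prop. 13.7); **§13.14 [p. 234]** "since `Z(f, T)/Z` is a
  finite group, `Z(f, T)_𝔭 ⊂ 𝐇¹(T)_𝔭` for any prime ideal `𝔭` of `Λ` of height one. Since `𝐇¹(T)` is a free `Λ`-module
  … this means `Z(f, T) ⊂ 𝐇¹(T)`."
* **§15.16 [p. 265]** "Since we have already proved Thm. 12.4 for `f`, Thm. 12.5 (1) (2) and Thm. 12.6 are proved by the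
  same arguments in 13.9–13.13."

## THE BRANCH READING (E3primeAudit-g58 §2–§4; why «`rank_Λ 𝐇¹ ≤ 1`» may replace Thm. 12.4 (2))

Every input of 13.9–13.13 (Thm. 13.5 Jacquet–Shalika/Rohrlich, Thm. 13.6 Ash–Stevens, Prop. 13.7, (8.1.3)/Prop. 8.12,
Thm. 6.6, Thm. 9.7, 13.9–13.13) is printed for ALL normalised newforms, all `p`, all `λ` — no «no CM», no `p ∤ N` —
EXCEPT Thm. 12.4 (2), which enters at exactly three places (13.9 independence of the choices, 13.10 the identities,
13.13) and only in the weak form «two elements of `𝐇¹(V_{F_λ}(f)) ⊗ Q(Λ)` with the same values at almost all finite-order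
characters `χ` are equal»; for `p` odd `Λ = ∏_{j ∈ ℤ/(p−1)} Λ_j` ((12.1.3), p. 220) and every object and step splits
along the idempotents, so on ONE branch — the `Δ`-trivial branch carried by the tree's pinned `I.H = 𝐇¹_Γ(T_pW)`
(READING of record of `IwasawaCohomology.lean`; FRAME LEMMA (T-f) of `GenusTypingMap-g57.md` §1 for the branch
bookkeeping, cited, not redone) — the needed form of 12.4 (2) is: «`I.H` is a torsion-free `Λ`-module of rank `≤ 1`»
(then `I.H ⊗_Λ Q(Λ)` has dimension `≤ 1`, a realised family with non-zero values makes it `1`, and an element `r·𝐳`,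
`r ∈ Λ`, with almost all `χ`-values zero is `0` by Weierstrass preparation and Rohrlich).  Torsion-freeness is a TREE
THEOREM for every `W`, `p` (`IwasawaH1Data.isTorsionFree`); «rank `≤ 1`» is the HYPOTHESIS of this file's fact — itself
a tree theorem from `rank_{ℤ_p} H¹(ℤ[1/p], T_pW) ≤ 1` (`IwasawaH1Data.rank_le_one_of_rank_integralH1_le_one`,
`IwasawaH1RankLeOneProofs.lean`), which the crux's GZK antecedent supplies (`rank_integralH1_layerZero_le_one`,
Summits side).  (ρ1′) The inverted primes: Kato's `𝐇¹(T) = lim←_n H¹(ℤ[ζ_{p^n}, 1/p], T)` (§12.2, (8.1.1): étale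
cohomology of `j_*T` on `Spec ℤ[ζ_{p^n}, 1/p]`, i.e. classes unramified outside `p`) and the tree's `I.H` (the pin's
`integralH1 (tateRep W p) p (K.layerSubgroup n)` = classes of `H¹(ℚ_n, T_pW)` unramified outside `p`, `IwasawaCohomology.lean`)
invert the SAME set `{p}` on the `Δ`-trivial component (restriction–corestriction along `ℚ(ζ_{p^{n+1}})/ℚ_n`, `|Δ|`
prime to `p`): this fact is stated over the tree's `I.H`, as are `thm12_4` and the two realisability facts.

## What is typed (the tree's currency: POSITION with respect to value-pinned families, as in `AdmissibleZetaClass` (A6′))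

In this directory Kato's `𝐳_{γ_W}` is not constructed; «`z₀ = 𝐳_{γ_W}` up to `Λˣ`» is ENCODED by its position
`((p : Λ)^{(−e)⁺}·M̃) • z₀ = (u·(p : Λ)^{e⁺}) • y` with respect to a VALUE-PINNED integral family — W2's
`DefinedExpStarBody` (the value functional IS the dual exponential in a Tate-duality-normalised coordinate), potss's
`ZetaBody` ((C1)–(C5): THE `(c, d₁, a, A)`-family and its value law, Thm. 6.6 (1)/9.7/Ex. 13.3), its `Λ`-adic lift
`y ∈ I.H` ((A4)), Kato's `Λ`-adic multiplier `M̃ = katoMultiplier …` (Lemma 13.10 (1)), the Manin datum `q⁻, nᵢ` and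
`e = v_p((Ω⁺_f/Ω_W)/(q q⁻))` ((A5′), (A6′)) — module docstring of `AdmissibleZetaClass.lean`, «WHY THIS IS KATO'S
ELEMENT».  Thm. 12.5 (1)'s VALUES of `𝐳_{γ_W}` at the characters `χ` of `Γ_n` (`n ≥ 1`; sign `+` and `γ⁺` only: every
`χ` of `Γ = G_∞/Δ` is even and the trivial branch sees `γ⁺_W`, loc. cit.) are therefore CARRIED by the position and the
family's pinned values (`M̃(χ)·L_{(p)}(W, χ̄, 1)/Ω_W` versus `q·R⁻_χ̄·∏_{ℓ∣A,ℓ≠p}P_ℓ(χ̄(ℓ)ℓ⁻¹)·L_{(p)}(W, χ̄, 1)/Ω⁺_f`,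
loc. cit.) — REUSED, not restated.  Accordingly:
* **(D1) `HasRealisedZetaFamilyBody W p K hK I`** — «some value-pinned `(c, d₁, a, A)`-family of `W` at `p` is
  REALISED in the given `I.H`»: VERBATIM the witnesses (A0)–(A4), (A5′) and the scalars of (A6′) of
  `AdmissibleZetaClassBody`, WITHOUT the class `z₀` and its position (the planner's «realisation datum», stated, not
  proved: for `W[p]` reducible the tree's Euler-system fact `exists_eulerSystem_definedExpStar_values` does not supply
  it; in print the integral classes live in `H¹` of Kato's lattice `V_{O_λ}(f)` ((8.1.3)) whatever the residual image,
  while their integrality in `T_pE` for `E[p]` reducible is announced, not printed — Burns–Sano et al., *On Euler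
  systems and Nekovář–Selmer complexes*, arXiv:2509.13894 (2025), §2.1, Remark after Thm. (Kato): «an analogue of the
  integrality property … also holds when `E[p]` is a reducible `𝔽_p[G_ℚ]`-representation … this will be discussed
  elsewhere»; C. Wuthrich, Doc. Math. 19 (2014) [Wuthrich2014] treats `p` semistable only).  Closed form
  `HasRealisedZetaFamily`.
* **(D2) `ZetaClassPositionBody W p K hK I k z₁`** — «`z₁ ∈ I.H` is `p^k·𝐳_{γ_W}`, UNIFORMLY»: for EVERY realised
  family (same binders, universally quantified) `z₁ ≠ 0` and `((p : Λ)^{(−e)⁺}·M̃) • z₁ = (u·(p : Λ)^{e⁺}·(p : Λ)^k) • y`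
  for some `u ∈ Λˣ`.  At `k = 0` and given ONE realised family this is `AdmissibleZetaClassBody … z₁`
  (`ZetaClassPositionBody.admissibleZetaClassBody`, kernel); conversely nothing is claimed.  Closed form
  `ZetaClassPosition`.
* **(F) the named fact `exists_zetaClassPosition_of_rank_le_one`** — for `W/ℚ` globally minimal, `p ≠ 2`, `K`
  cyclotomic with topological generator `γ`, and EVERY pin `I : IwasawaH1Data W p K γ` with `Module.rank Λ I.H ≤ 1`:
  `∃ (z₁ : I.H) (k : ℕ), ZetaClassPosition W p K hK I k z₁`.  CONTENT = Thm. 12.5 (1) (existence AND uniqueness of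
  `γ ↦ 𝐳_γ`, membership `𝐳_γ ∈ 𝐇¹(T) ⊗ ℚ = 𝐇¹(T)[1/p]` — §13.12 —, whence `p^k·𝐳_{γ_W} ∈ 𝐇¹(T)` for some `k`), §13.9
  «independent of the choices» and Lemma 13.10 (1) (ONE element serves every `(c, d₁, a, A)`-family), Thm. 12.5 (2)
  (`𝐳 ≠ 0`, Prop. 13.7), all on the `Δ`-trivial branch with 12.4 (2) := «rank `≤ 1`» (+ tree torsion-freeness).
  If no family is realised in `I.H` the conclusion is vacuous (nothing is then claimed).
* **NOT transcribed: the finite-index clause of Thm. 12.6** («`Z(f, T)/Z` finite»).  Reasons: (a) Kato's `Z` is spanned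
  by BOTH the `a(A)`-type classes (the tree's `ZetaBody` families) and the `SL₂(ℤ)`-type classes (tree: a separate
  one-level value fact `exists_member_sl2ZetaElement_neron_values`, no `Λ`-adic family), and §13.12 uses the latter
  (with Thm. 13.6) for the `𝔭 = (p)` part — a faithful `Z` is not available as ONE tree object; (b) its `𝔭 ≠ (p)` content
  is INSIDE (F) (`z₁ ∈ I.H`, i.e. `𝐳_{γ_W}` is `𝔭`-integral at every height-one `𝔭 ∌ p`, which is how §13.12 proves
  `z_γ ∈ 𝐇¹(V)`); (c) its `𝔭 = (p)` content is what a consumer recovers from (F) and ONE explicit realised family whose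
  multiplier is `μ`-free (`M̃ ∉ pΛ`: e.g. `[a/A]⁻_f/q⁻` a `p`-adic unit and `c ≡ d₁ ≡ d′ ≡ 1 (mod A)`, when
  `M̃ = n₁·c d₁(c − Ψ_c)(d₁ − Ψ_{d₁})·∏_ℓ(…)`, `constantCoeff_katoMultiplier`) with `e ≥ 0`: in a FREE rank-one `I.H ≅ Λ`
  (kernel lemma `IwasawaH1Data.moduleFree_of_torsionBy_eq_bot` when `W(ℚ)[p] = 0`) write `z₁ = h·b`, `y = g·b`; the
  position reads `M̃·h = u·p^{e+k}·g` in the UFD `Λ = ℤ_p⟦T⟧` with `p ∤ M̃`, hence `p^k ∣ h`, i.e. `𝐳_{γ_W} = z₁/p^k ∈ I.H`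
  — §13.14's argument on the branch; then `ZetaClassPositionBody.of_pow_smul` and `.admissibleZetaClassBody` give an
  ADMISSIBLE class.  That route-side step (the cell's row (GENUS-PORT) F8) is where the member of the isogeny class and
  the sign of `e` matter; this file is member-independent.
  -- TODO(general form): Thm. 12.6's finite-index clause `Z(f, T)/Z` finite with Kato's full `Z` (both `ξ`-types), all
  -- `Δ`-branches over `O_λ⟦G_∞⟧`, newforms of weight `k ≥ 2` with coefficients; Thm. 12.5 (1) for all `r`, `γ` (not only
  -- `γ⁺_W`, `r = 1`); Thm. 12.5 (3)/(4) are elsewhere (`kato_divisibility`, the realisability facts).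

## Consumers (Summits side; nothing of it is asserted here)

Crux stmt-BirchSwinnertonDyer-19945, stub 2★ `stub_primitiveAdmissibleMemberSeven`: (ii) existence of an admissible
class at the modular-lattice member `W′` of a class `𝒞₇` at `p = 7` = (F) at `W′` (rank `≤ 1` from GZK by the tree) +
ONE realised `μ`-free family with `e ≥ 0` ((E2) of `ExistenceConjunct-g57.md`) + kernel freeness + the bridges below;
and K2ᶜ's LEMMA S (values of `𝐳_{γ′}` through the position).  It also re-reads the «outside print» caveat of
`AdmissibleZetaClassRealisabilityCM.lean` at (`ℚ(√−7)`, `7`): realisability there = (F) + kernel + (E2).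

References: [Kato2004Asterisque] Thm. 12.4 (2), Thm. 12.5 (1)(2) (p. 221), Thm. 12.6 (p. 222), (12.1.3) (p. 220), §13.9
(pp. 229–230, esp. p. 230 l. 8–9), Lemma 13.10 (1) (p. 230), Lemma 13.11 (p. 231), §13.12–13.13 (pp. 231–233), §13.14
(p. 234), Prop. 13.7 (p. 227), Thm. 13.5–13.6 (pp. 226–227), §15.16 (p. 265); [RohrlichInventiones1984] (generic
non-vanishing, through Thm. 13.5 (2)); [Manin1972] Cor. 3.6 (the lattice of minus symbols); [BlochKato1990] §3 (the
dual exponential, through `DefinedExpStarBody`).  Tree: `Kato2004/AdmissibleZetaClass.lean` (v2; (A0)–(A6′),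
`katoMultiplier`, scale/junk audits), `Kato2004/AdmissibleZetaClassRealisability(CM).lean`, `Kato2004/IwasawaH1RankLeOneProofs.lean`,
`Kato2004/IwasawaH1LambdaTorsionFreeProofs.lean`, `Kato2004/IwasawaH1FreeOfNoRationalTorsionProofs.lean`,
`Kato2004/EulerSystemValues.lean` (`ZetaBody`), `Kato2004/EulerSystemDefinedValues.lean` (`DefinedExpStarBody`);
cell records `Cruxes/EllipticUnitValueSevenOfGZK/E3primeAudit-g58.md` REV 1.1, `K2cCollapse-g57.md` REV 1.1,
`ExistenceConjunct-g57.md` REV 1.1, `GenusTypingMap-g57.md` REV 1.1 §1 (FRAME LEMMA).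
-/

noncomputable section

open scoped BigOperators NumberField TensorProduct Classical
open Field IsDedekindDomain NumberField CongruenceSubgroup ValuativeRel
open Literature.NumberTheory.GaloisRepresentations
open Literature.NumberTheory.GaloisRepresentations.PeriodRingData
open Literature.NumberTheory.GaloisRepresentations.IsNonarchimedeanLocalField
open Literature.NumberTheory.PAdicHodge
open Literature.NumberTheory.EllipticCurves Literature.NumberTheory.EllipticCurves.ModularForms
open Literature.NumberTheory.AdelicBaseChange Literature.NumberTheory.Automorphic

namespace Literature.NumberTheory.EllipticCurves.Kato2004

open EulerSystemValues Rat.HeightOneSpectrum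

/-! ## §1 (D1) A value-pinned family REALISED in the given pin `I` (the realisation datum) -/

set_option backward.isDefEq.respectTransparency false in
/-- **`HasRealisedZetaFamilyBody W p K hK I` — «some VALUE-PINNED integral `(c, d₁, a, A)`-family of Kato zeta classes of
`W` at `p` is REALISED in the pinned Iwasawa cohomology `I.H = 𝐇¹_Γ(T_pW)`, together with its bookkeeping data»**:
VERBATIM the existential witnesses (A0) `p ≠ 2`, the level and newform of `W`, W2's datum `(ι, q, Λ)` with `q ≠ 0`;
(A1) ∧ (A2) `DefinedExpStarBody` for a Tate-duality-normalised generator `d`; (A3) Kato's parameters `(c, d₁, a, A, d′)`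
with the printed guards, `R⁻_𝟙 ≠ 0`, and THE family `(z, x)` with `ZetaBody`; (A4) its `Λ`-adic lift `y ∈ I.H`
(`I.proj n y = levelToLayer … (z_{n+1,∅})`); (A5′) the Manin generator `q⁻`, the integer coordinates `n₁ … n₄`, Galois
elements `σc, σd, σℓ` of cyclotomic character `c, d₁, ℓ`; and the scalars of (A6′): the period ratio `λ ≠ 0`
(`plusPeriod f = λ · W.realPeriodRat`) and `e = v_p(λ/(q·q⁻))` — of `AdmissibleZetaClassBody` (module docstring of
`AdmissibleZetaClass.lean`), WITHOUT the class `z₀` and WITHOUT its position.  The three `ℤ_p`-structure facts of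
`T_pW` are instance BINDERS.  A `Prop`; a HYPOTHESIS shape (the realisation datum of the consumers); nothing asserted
— in particular NOT that such a family exists (for `W[p]` irreducible the tree facts
`exists_eulerSystem_definedExpStar_values` + `IwasawaH1Data.exists_unique_lift` supply (A0)–(A4); in general, print:
Kato (8.1.3), Prop. 8.12, Thm. 9.7 at the lattice `V_{O_λ}(f)`).
[cite: Kato2004Asterisque, (8.1.3) (p. 180), Prop. 8.12 (p. 186), Thm. 9.7 (p. 189), Thm. 6.6 (1) (p. 163), Ex. 13.3 (pp. 224–225), Lemma 13.10 (1) (p. 230)]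
[cite: BlochKato1990, Prop. 3.8 (p. 354) and Example 3.11 (p. 361)] [cite: Manin1972, Thm. 1.6 and Cor. 3.6] -/
def HasRealisedZetaFamilyBody (W : WeierstrassCurve ℚ) [W.IsElliptic] [W.IsGloballyMinimal] (p : ℕ) [Fact p.Prime]
    [ContinuousSMul ℤ_[p] (W.tateModule p)] [Module.Free ℤ_[p] (W.tateModule p)]
    [Module.Finite ℤ_[p] (W.tateModule p)] (K : ZpExtension ℚ p) (hK : K.IsCyclotomic)
    {γ : absoluteGaloisGroup ℚ} (I : IwasawaH1Data W p K γ) : Prop :=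
  letI ρT := restrictedTateRep W (NumberField.Place.Completion (Sum.inr ((Rat.HeightOneSpectrum.primesEquiv (R := 𝓞 ℚ)).symm ⟨p, Fact.out⟩) : NumberField.Place ℚ)) p
  letI : ValuativeRel (NumberField.Place.Completion (Sum.inr ((Rat.HeightOneSpectrum.primesEquiv (R := 𝓞 ℚ)).symm ⟨p, Fact.out⟩) : NumberField.Place ℚ)) :=
    inferInstanceAs (ValuativeRel (((Rat.HeightOneSpectrum.primesEquiv (R := 𝓞 ℚ)).symm ⟨p, Fact.out⟩).adicCompletion ℚ))
  letI : TopologicalSpace (NumberField.Place.Completion (Sum.inr ((Rat.HeightOneSpectrum.primesEquiv (R := 𝓞 ℚ)).symm ⟨p, Fact.out⟩) : NumberField.Place ℚ)) :=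
    inferInstanceAs (TopologicalSpace (((Rat.HeightOneSpectrum.primesEquiv (R := 𝓞 ℚ)).symm ⟨p, Fact.out⟩).adicCompletion ℚ))
  haveI : IsNonarchimedeanLocalField (NumberField.Place.Completion (Sum.inr ((Rat.HeightOneSpectrum.primesEquiv (R := 𝓞 ℚ)).symm ⟨p, Fact.out⟩) : NumberField.Place ℚ)) :=
    inferInstanceAs (IsNonarchimedeanLocalField (((Rat.HeightOneSpectrum.primesEquiv (R := 𝓞 ℚ)).symm ⟨p, Fact.out⟩).adicCompletion ℚ))
  haveI : CharZero (NumberField.Place.Completion (Sum.inr ((Rat.HeightOneSpectrum.primesEquiv (R := 𝓞 ℚ)).symm ⟨p, Fact.out⟩) : NumberField.Place ℚ)) := LocalField.charZero_adicCompletion ((Rat.HeightOneSpectrum.primesEquiv (R := 𝓞 ℚ)).symm ⟨p, Fact.out⟩)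
  letI : Algebra ℚ_[p] (NumberField.Place.Completion (Sum.inr ((Rat.HeightOneSpectrum.primesEquiv (R := 𝓞 ℚ)).symm ⟨p, Fact.out⟩) : NumberField.Place ℚ)) :=
    LocalField.adicCompletionPadicAlgebra ((Rat.HeightOneSpectrum.primesEquiv (R := 𝓞 ℚ)).symm ⟨p, Fact.out⟩) p ((natCast_mem_asIdeal_iff_eq_primesEquiv_symm _ (Fact.out : p.Prime)).mpr rfl)
  haveI : Fact (¬ IsUnit ((p : ℕ) : integerC (NumberField.Place.Completion (Sum.inr ((Rat.HeightOneSpectrum.primesEquiv (R := 𝓞 ℚ)).symm ⟨p, Fact.out⟩) : NumberField.Place ℚ)))) :=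
    ⟨not_isUnit_natCast_integerC (show valuation (NumberField.Place.Completion (Sum.inr ((Rat.HeightOneSpectrum.primesEquiv (R := 𝓞 ℚ)).symm ⟨p, Fact.out⟩) : NumberField.Place ℚ)) ((p : ℕ) : (NumberField.Place.Completion (Sum.inr ((Rat.HeightOneSpectrum.primesEquiv (R := 𝓞 ℚ)).symm ⟨p, Fact.out⟩) : NumberField.Place ℚ))) < 1 from LocalField.valuation_adicCompletion_natCast_lt_one ((Rat.HeightOneSpectrum.primesEquiv (R := 𝓞 ℚ)).symm ⟨p, Fact.out⟩) p ((natCast_mem_asIdeal_iff_eq_primesEquiv_symm _ (Fact.out : p.Prime)).mpr rfl))⟩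
  haveI := isAdicComplete_integerC_natCast (show valuation (NumberField.Place.Completion (Sum.inr ((Rat.HeightOneSpectrum.primesEquiv (R := 𝓞 ℚ)).symm ⟨p, Fact.out⟩) : NumberField.Place ℚ)) ((p : ℕ) : (NumberField.Place.Completion (Sum.inr ((Rat.HeightOneSpectrum.primesEquiv (R := 𝓞 ℚ)).symm ⟨p, Fact.out⟩) : NumberField.Place ℚ))) < 1 from LocalField.valuation_adicCompletion_natCast_lt_one ((Rat.HeightOneSpectrum.primesEquiv (R := 𝓞 ℚ)).symm ⟨p, Fact.out⟩) p ((natCast_mem_asIdeal_iff_eq_primesEquiv_symm _ (Fact.out : p.Prime)).mpr rfl))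
  -- the tree's `ℚ`-algebra structure on `ℚ_v` (the one W2's restricted representations are built on) is pinned
  -- as the most recent local instance, so that it — and not `DivisionRing.toRatAlgebra` — is synthesized below
  letI : Algebra ℚ (NumberField.Place.Completion (Sum.inr ((Rat.HeightOneSpectrum.primesEquiv (R := 𝓞 ℚ)).symm ⟨p, Fact.out⟩) : NumberField.Place ℚ)) := NumberField.Place.instAlgebraCompletion (Sum.inr ((Rat.HeightOneSpectrum.primesEquiv (R := 𝓞 ℚ)).symm ⟨p, Fact.out⟩) : NumberField.Place ℚ)
  ∃ (hp : p ≠ 2) (N : ℕ) (_ : NeZero N) (f : CuspForm (Gamma0 N) 2) (_ : IsNewformOf W f)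
    (ι : (n : ℕ) → (CyclotomicField n ℚ →+* ℂ)) (q : ℚ)
    (Λ : ∀ (k : ℕ) (r : Finset (HeightOneSpectrum (𝓞 ℚ))),
      H1 (tateRep W p) (cycSubgroup p k r) →ₗ[ℤ_[p]] ℚ_[p] ⊗[ℚ] CyclotomicField (cycLevel p k r) ℚ),
    -- (A0) the constant of the value law is non-zero
    q ≠ 0 ∧
    -- (A1) ∧ (A2): the value functional IS the dual exponential in a Tate-duality-normalised coordinate `d`
    (∃ d, DefinedExpStarBody W p f d ι ((q : ℚ) : ℝ) Λ ∧
      ∀ a : (NumberField.Place.Completion (Sum.inr ((Rat.HeightOneSpectrum.primesEquiv (R := 𝓞 ℚ)).symm ⟨p, Fact.out⟩) : NumberField.Place ℚ)),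
        (∃ η : contOneCocycles ρT.toTopRep, expStarCoord W (show valuation (NumberField.Place.Completion (Sum.inr ((Rat.HeightOneSpectrum.primesEquiv (R := 𝓞 ℚ)).symm ⟨p, Fact.out⟩) : NumberField.Place ℚ)) ((p : ℕ) : (NumberField.Place.Completion (Sum.inr ((Rat.HeightOneSpectrum.primesEquiv (R := 𝓞 ℚ)).symm ⟨p, Fact.out⟩) : NumberField.Place ℚ))) < 1 from LocalField.valuation_adicCompletion_natCast_lt_one ((Rat.HeightOneSpectrum.primesEquiv (R := 𝓞 ℚ)).symm ⟨p, Fact.out⟩) p ((natCast_mem_asIdeal_iff_eq_primesEquiv_symm _ (Fact.out : p.Prime)).mpr rfl)) d η = a) ↔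
          ∀ Q : (W.baseChange ℚ_[p]).toAffine.Point,
            ‖(Padic.adicCompletionEquiv (𝓞 ℚ) ⟨p, Fact.out⟩).symm
                (show ((Rat.HeightOneSpectrum.primesEquiv (R := 𝓞 ℚ)).symm ⟨p, Fact.out⟩).adicCompletion ℚ from a) * padicLogLocal W p Q‖ ≤ 1) ∧
    -- (A3) Kato's parameters with the printed guards, and THE family
    ∃ (c d₁ a : ℤ) (A : ℕ) (d' : ℤ),
      0 < A ∧ Int.gcd c (6 * p * A) = 1 ∧ Int.gcd d₁ (6 * p * N) = 1 ∧ (d₁ : ℤ) * d' ≡ 1 [ZMOD (A : ℤ)] ∧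
      ratCuspFactor f true c d₁ a A d' ≠ 0 ∧
    ∃ (z : ∀ (k : ℕ) (r : (cyclotomicLevelsRat p (badPlaces c d₁ A N)).Ideals),
        H1 (tateRep W p) ((cyclotomicLevelsRat p (badPlaces c d₁ A N)).level k r.1))
      (x : ∀ (k : ℕ) (r : (cyclotomicLevelsRat p (badPlaces c d₁ A N)).Ideals),
        CyclotomicField (cycLevel p k r.1) ℚ),
      ZetaBody W p f ι ((q : ℚ) : ℝ) Λ c d₁ a A z x ∧
    -- (A4) the Λ-adic lift INTO THE GIVEN `I` — this is the REALISATION DATUM (the classes land in `I.H`)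
    ∃ (y : I.H),
      (∀ n : ℕ, I.proj n y =
        levelToLayer W p hK hp (badPlaces c d₁ A N) n
          (z (n + 1) (cyclotomicLevelsRat p (badPlaces c d₁ A N)).idealOne)) ∧
    -- (A5′) ∧ (A6′-scalars): the Manin lattice datum, the Galois elements of the multiplier, the period ratio and `e`
    ∃ (qm perRatio : ℚ) (e : ℤ) (n₁ n₂ n₃ n₄ : ℤ) (σc σd : absoluteGaloisGroup ℚ)
      (σℓ : ℕ → absoluteGaloisGroup ℚ),
      0 < qm ∧ AddSubgroup.closure (Set.range (ratMinusSymbol f)) = AddSubgroup.zmultiples qm ∧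
      ratMinusSymbol f ((a : ℚ) / A) = n₁ * qm ∧ ratMinusSymbol f ((a * c : ℚ) / A) = n₂ * qm ∧
      ratMinusSymbol f ((a * d' : ℚ) / A) = n₃ * qm ∧ ratMinusSymbol f ((a * c * d' : ℚ) / A) = n₄ * qm ∧
      ((GaloisRep.cyclotomicCharacter ℚ p σc : ℤ_[p]ˣ) : ℤ_[p]) = c ∧
      ((GaloisRep.cyclotomicCharacter ℚ p σd : ℤ_[p]ˣ) : ℤ_[p]) = d₁ ∧
      (∀ ℓ ∈ A.primeFactors.erase p, ((GaloisRep.cyclotomicCharacter ℚ p (σℓ ℓ) : ℤ_[p]ˣ) : ℤ_[p]) = ℓ) ∧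
      perRatio ≠ 0 ∧ plusPeriod f = ((perRatio : ℚ) : ℝ) * W.realPeriodRat ∧
      padicValRat p (perRatio / (q * qm)) = e

/-! ## §2 (D2) The UNIFORM position «`z₁ = p^k · 𝐳_{γ_W}`» with respect to every realised family -/

set_option backward.isDefEq.respectTransparency false in
/-- **`ZetaClassPositionBody W p K hK I k z₁` — «`z₁ ∈ I.H = 𝐇¹_Γ(T_pW)` is `p^k` times Kato's `Ω_W`-normalised zeta
class `𝐳_{γ_W}`, UNIFORMLY with respect to every value-pinned family realised in `I.H`»**: for ALL data (A0)–(A4),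
(A5′), (A6′-scalars) as in `HasRealisedZetaFamilyBody` (same binders, universally quantified), `z₁ ≠ 0` (Thm. 12.5 (2))
and the POSITION THROUGH THE MULTIPLIER holds with an extra `p^k`:
`((p : Λ)^{(−e)⁺} · M̃) • z₁ = (u · (p : Λ)^{e⁺} · (p : Λ)^k) • y` for some unit `u` of `Λ = IwasawaAlgebra p`,
`M̃ = katoMultiplier …` (Lemma 13.10 (1); `AdmissibleZetaClass.lean` §0) — i.e. `M̃·𝐳_{γ_W} = u·p^e·y` in `I.H ⊗ ℚ`
with `z₁ = p^k·𝐳_{γ_W}`, the SAME `z₁` for every family (§13.9 «`z_γ^{(p)}` is independent of the choices», Thm. 12.5 (1)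
uniqueness).  At `k = 0`, given one realised family, this is `AdmissibleZetaClassBody` (`admissibleZetaClassBody`);
vacuous if no family is realised.  The three `ℤ_p`-structure facts of `T_pW` are instance BINDERS.  A `Prop`; nothing
asserted.
[cite: Kato2004Asterisque, Thm. 12.5 (1)(2) (p. 221), §13.9 (p. 230 l. 8–9, "independent of the choices"), Lemma 13.10 (1) (p. 230), §13.12 (pp. 231–233)]
[cite: Kato1993LNM1553, Ch. II Thm. 1.4.1 (3)–(4)] [cite: BlochKato1990, Prop. 3.8 (p. 354) and Example 3.11 (p. 361)]
[cite: Manin1972, Thm. 1.6 and Cor. 3.6] -/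
def ZetaClassPositionBody (W : WeierstrassCurve ℚ) [W.IsElliptic] [W.IsGloballyMinimal] (p : ℕ) [Fact p.Prime]
    [ContinuousSMul ℤ_[p] (W.tateModule p)] [Module.Free ℤ_[p] (W.tateModule p)]
    [Module.Finite ℤ_[p] (W.tateModule p)] (K : ZpExtension ℚ p) (hK : K.IsCyclotomic)
    {γ : absoluteGaloisGroup ℚ} (I : IwasawaH1Data W p K γ) (k : ℕ) (z₁ : I.H) : Prop :=
  letI ρT := restrictedTateRep W (NumberField.Place.Completion (Sum.inr ((Rat.HeightOneSpectrum.primesEquiv (R := 𝓞 ℚ)).symm ⟨p, Fact.out⟩) : NumberField.Place ℚ)) p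
  letI : ValuativeRel (NumberField.Place.Completion (Sum.inr ((Rat.HeightOneSpectrum.primesEquiv (R := 𝓞 ℚ)).symm ⟨p, Fact.out⟩) : NumberField.Place ℚ)) :=
    inferInstanceAs (ValuativeRel (((Rat.HeightOneSpectrum.primesEquiv (R := 𝓞 ℚ)).symm ⟨p, Fact.out⟩).adicCompletion ℚ))
  letI : TopologicalSpace (NumberField.Place.Completion (Sum.inr ((Rat.HeightOneSpectrum.primesEquiv (R := 𝓞 ℚ)).symm ⟨p, Fact.out⟩) : NumberField.Place ℚ)) :=
    inferInstanceAs (TopologicalSpace (((Rat.HeightOneSpectrum.primesEquiv (R := 𝓞 ℚ)).symm ⟨p, Fact.out⟩).adicCompletion ℚ))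
  haveI : IsNonarchimedeanLocalField (NumberField.Place.Completion (Sum.inr ((Rat.HeightOneSpectrum.primesEquiv (R := 𝓞 ℚ)).symm ⟨p, Fact.out⟩) : NumberField.Place ℚ)) :=
    inferInstanceAs (IsNonarchimedeanLocalField (((Rat.HeightOneSpectrum.primesEquiv (R := 𝓞 ℚ)).symm ⟨p, Fact.out⟩).adicCompletion ℚ))
  haveI : CharZero (NumberField.Place.Completion (Sum.inr ((Rat.HeightOneSpectrum.primesEquiv (R := 𝓞 ℚ)).symm ⟨p, Fact.out⟩) : NumberField.Place ℚ)) := LocalField.charZero_adicCompletion ((Rat.HeightOneSpectrum.primesEquiv (R := 𝓞 ℚ)).symm ⟨p, Fact.out⟩)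
  letI : Algebra ℚ_[p] (NumberField.Place.Completion (Sum.inr ((Rat.HeightOneSpectrum.primesEquiv (R := 𝓞 ℚ)).symm ⟨p, Fact.out⟩) : NumberField.Place ℚ)) :=
    LocalField.adicCompletionPadicAlgebra ((Rat.HeightOneSpectrum.primesEquiv (R := 𝓞 ℚ)).symm ⟨p, Fact.out⟩) p ((natCast_mem_asIdeal_iff_eq_primesEquiv_symm _ (Fact.out : p.Prime)).mpr rfl)
  haveI : Fact (¬ IsUnit ((p : ℕ) : integerC (NumberField.Place.Completion (Sum.inr ((Rat.HeightOneSpectrum.primesEquiv (R := 𝓞 ℚ)).symm ⟨p, Fact.out⟩) : NumberField.Place ℚ)))) :=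
    ⟨not_isUnit_natCast_integerC (show valuation (NumberField.Place.Completion (Sum.inr ((Rat.HeightOneSpectrum.primesEquiv (R := 𝓞 ℚ)).symm ⟨p, Fact.out⟩) : NumberField.Place ℚ)) ((p : ℕ) : (NumberField.Place.Completion (Sum.inr ((Rat.HeightOneSpectrum.primesEquiv (R := 𝓞 ℚ)).symm ⟨p, Fact.out⟩) : NumberField.Place ℚ))) < 1 from LocalField.valuation_adicCompletion_natCast_lt_one ((Rat.HeightOneSpectrum.primesEquiv (R := 𝓞 ℚ)).symm ⟨p, Fact.out⟩) p ((natCast_mem_asIdeal_iff_eq_primesEquiv_symm _ (Fact.out : p.Prime)).mpr rfl))⟩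
  haveI := isAdicComplete_integerC_natCast (show valuation (NumberField.Place.Completion (Sum.inr ((Rat.HeightOneSpectrum.primesEquiv (R := 𝓞 ℚ)).symm ⟨p, Fact.out⟩) : NumberField.Place ℚ)) ((p : ℕ) : (NumberField.Place.Completion (Sum.inr ((Rat.HeightOneSpectrum.primesEquiv (R := 𝓞 ℚ)).symm ⟨p, Fact.out⟩) : NumberField.Place ℚ))) < 1 from LocalField.valuation_adicCompletion_natCast_lt_one ((Rat.HeightOneSpectrum.primesEquiv (R := 𝓞 ℚ)).symm ⟨p, Fact.out⟩) p ((natCast_mem_asIdeal_iff_eq_primesEquiv_symm _ (Fact.out : p.Prime)).mpr rfl))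
  -- the tree's `ℚ`-algebra structure on `ℚ_v` (the one W2's restricted representations are built on) is pinned
  -- as the most recent local instance, so that it — and not `DivisionRing.toRatAlgebra` — is synthesized below
  letI : Algebra ℚ (NumberField.Place.Completion (Sum.inr ((Rat.HeightOneSpectrum.primesEquiv (R := 𝓞 ℚ)).symm ⟨p, Fact.out⟩) : NumberField.Place ℚ)) := NumberField.Place.instAlgebraCompletion (Sum.inr ((Rat.HeightOneSpectrum.primesEquiv (R := 𝓞 ℚ)).symm ⟨p, Fact.out⟩) : NumberField.Place ℚ)
  ∀ (hp : p ≠ 2) (N : ℕ) (_ : NeZero N) (f : CuspForm (Gamma0 N) 2) (_ : IsNewformOf W f)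
    (ι : (n : ℕ) → (CyclotomicField n ℚ →+* ℂ)) (q : ℚ)
    (Λ : ∀ (k : ℕ) (r : Finset (HeightOneSpectrum (𝓞 ℚ))),
      H1 (tateRep W p) (cycSubgroup p k r) →ₗ[ℤ_[p]] ℚ_[p] ⊗[ℚ] CyclotomicField (cycLevel p k r) ℚ),
    -- (A0)
    q ≠ 0 →
    -- (A1) ∧ (A2)
    (∃ d, DefinedExpStarBody W p f d ι ((q : ℚ) : ℝ) Λ ∧
      ∀ a : (NumberField.Place.Completion (Sum.inr ((Rat.HeightOneSpectrum.primesEquiv (R := 𝓞 ℚ)).symm ⟨p, Fact.out⟩) : NumberField.Place ℚ)),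
        (∃ η : contOneCocycles ρT.toTopRep, expStarCoord W (show valuation (NumberField.Place.Completion (Sum.inr ((Rat.HeightOneSpectrum.primesEquiv (R := 𝓞 ℚ)).symm ⟨p, Fact.out⟩) : NumberField.Place ℚ)) ((p : ℕ) : (NumberField.Place.Completion (Sum.inr ((Rat.HeightOneSpectrum.primesEquiv (R := 𝓞 ℚ)).symm ⟨p, Fact.out⟩) : NumberField.Place ℚ))) < 1 from LocalField.valuation_adicCompletion_natCast_lt_one ((Rat.HeightOneSpectrum.primesEquiv (R := 𝓞 ℚ)).symm ⟨p, Fact.out⟩) p ((natCast_mem_asIdeal_iff_eq_primesEquiv_symm _ (Fact.out : p.Prime)).mpr rfl)) d η = a) ↔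
          ∀ Q : (W.baseChange ℚ_[p]).toAffine.Point,
            ‖(Padic.adicCompletionEquiv (𝓞 ℚ) ⟨p, Fact.out⟩).symm
                (show ((Rat.HeightOneSpectrum.primesEquiv (R := 𝓞 ℚ)).symm ⟨p, Fact.out⟩).adicCompletion ℚ from a) * padicLogLocal W p Q‖ ≤ 1) →
    -- (A3)
    ∀ (c d₁ a : ℤ) (A : ℕ) (d' : ℤ),
      0 < A → Int.gcd c (6 * p * A) = 1 → Int.gcd d₁ (6 * p * N) = 1 → (d₁ : ℤ) * d' ≡ 1 [ZMOD (A : ℤ)] →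
      ratCuspFactor f true c d₁ a A d' ≠ 0 →
    ∀ (z : ∀ (k : ℕ) (r : (cyclotomicLevelsRat p (badPlaces c d₁ A N)).Ideals),
        H1 (tateRep W p) ((cyclotomicLevelsRat p (badPlaces c d₁ A N)).level k r.1))
      (x : ∀ (k : ℕ) (r : (cyclotomicLevelsRat p (badPlaces c d₁ A N)).Ideals),
        CyclotomicField (cycLevel p k r.1) ℚ),
      ZetaBody W p f ι ((q : ℚ) : ℝ) Λ c d₁ a A z x →
    -- (A4) the realisation datum
    ∀ (y : I.H),
      (∀ n : ℕ, I.proj n y =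
        levelToLayer W p hK hp (badPlaces c d₁ A N) n
          (z (n + 1) (cyclotomicLevelsRat p (badPlaces c d₁ A N)).idealOne)) →
    -- (A5′) ∧ (A6′-scalars)
    ∀ (qm perRatio : ℚ) (e : ℤ) (n₁ n₂ n₃ n₄ : ℤ) (σc σd : absoluteGaloisGroup ℚ)
      (σℓ : ℕ → absoluteGaloisGroup ℚ),
      0 < qm → AddSubgroup.closure (Set.range (ratMinusSymbol f)) = AddSubgroup.zmultiples qm →
      ratMinusSymbol f ((a : ℚ) / A) = n₁ * qm → ratMinusSymbol f ((a * c : ℚ) / A) = n₂ * qm →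
      ratMinusSymbol f ((a * d' : ℚ) / A) = n₃ * qm → ratMinusSymbol f ((a * c * d' : ℚ) / A) = n₄ * qm →
      ((GaloisRep.cyclotomicCharacter ℚ p σc : ℤ_[p]ˣ) : ℤ_[p]) = c →
      ((GaloisRep.cyclotomicCharacter ℚ p σd : ℤ_[p]ˣ) : ℤ_[p]) = d₁ →
      (∀ ℓ ∈ A.primeFactors.erase p, ((GaloisRep.cyclotomicCharacter ℚ p (σℓ ℓ) : ℤ_[p]ˣ) : ℤ_[p]) = ℓ) →
      perRatio ≠ 0 → plusPeriod f = ((perRatio : ℚ) : ℝ) * W.realPeriodRat →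
      padicValRat p (perRatio / (q * qm)) = e →
      -- CONCLUSION: Thm. 12.5 (2) on the branch (`𝐳_{γ_W} ≠ 0`) and the UNIFORM POSITION «`z₁ = p^k · 𝐳_{γ_W}`»
      -- (Thm. 12.5 (1) with §13.9 «independent of the choices» and Lemma 13.10 (1), on the branch)
      z₁ ≠ 0 ∧ ∃ u : (IwasawaAlgebra p)ˣ,
        ((p : IwasawaAlgebra p) ^ (-e).toNat *
          katoMultiplier p c d₁ n₁ n₂ n₃ n₄
            ((IwasawaCharacter.Psi p ℤ_[p] K σc : (PowerSeries ℤ_[p])ˣ) : IwasawaAlgebra p)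
            ((IwasawaCharacter.Psi p ℤ_[p] K σd : (PowerSeries ℤ_[p])ˣ) : IwasawaAlgebra p)
            (A.primeFactors.erase p) (fun ℓ => W.LFunction ℓ) (fun ℓ => if ℓ ∣ N then 0 else 1)
            (fun ℓ => ((IwasawaCharacter.Psi p ℤ_[p] K (σℓ ℓ) : (PowerSeries ℤ_[p])ˣ) : IwasawaAlgebra p))) • z₁ =
        ((u : IwasawaAlgebra p) * (p : IwasawaAlgebra p) ^ e.toNat * (p : IwasawaAlgebra p) ^ k) • y

/-! ## §3 The closed predicates (the `ℤ_p`-structure facts of `T_pW` supplied by the tree theorems) -/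

/-- **`HasRealisedZetaFamily W p K hK I`**, CLOSED: `HasRealisedZetaFamilyBody` with `Module.Free`/`Module.Finite` of
`T_pW` supplied by `module_free_tateModule_holds` / `module_finite_tateModule_holds` (as `IsAdmissibleZetaClass`).
[cite: Kato2004Asterisque, (8.1.3) (p. 180), Thm. 9.7 (p. 189), Lemma 13.10 (1) (p. 230)] -/
def HasRealisedZetaFamily (W : WeierstrassCurve ℚ) [W.IsElliptic] [W.IsGloballyMinimal] (p : ℕ) [Fact p.Prime]
    [ContinuousSMul ℤ_[p] (W.tateModule p)] (K : ZpExtension ℚ p) (hK : K.IsCyclotomic)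
    {γ : absoluteGaloisGroup ℚ} (I : IwasawaH1Data W p K γ) : Prop :=
  letI : Module.Free ℤ_[p] (W.tateModule p) := W.module_free_tateModule_holds p
  letI : Module.Finite ℤ_[p] (W.tateModule p) := W.module_finite_tateModule_holds p
  HasRealisedZetaFamilyBody W p K hK I

/-- **`ZetaClassPosition W p K hK I k z₁`**, CLOSED: `ZetaClassPositionBody` with `Module.Free`/`Module.Finite` of `T_pW`
supplied by the tree theorems (as `IsAdmissibleZetaClass`). [cite: Kato2004Asterisque, Thm. 12.5 (1)(2) (p. 221), §13.9 (p. 230), Lemma 13.10 (1) (p. 230)] -/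
def ZetaClassPosition (W : WeierstrassCurve ℚ) [W.IsElliptic] [W.IsGloballyMinimal] (p : ℕ) [Fact p.Prime]
    [ContinuousSMul ℤ_[p] (W.tateModule p)] (K : ZpExtension ℚ p) (hK : K.IsCyclotomic)
    {γ : absoluteGaloisGroup ℚ} (I : IwasawaH1Data W p K γ) (k : ℕ) (z₁ : I.H) : Prop :=
  letI : Module.Free ℤ_[p] (W.tateModule p) := W.module_free_tateModule_holds p
  letI : Module.Finite ℤ_[p] (W.tateModule p) := W.module_finite_tateModule_holds p
  ZetaClassPositionBody W p K hK I k z₁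

section Bridges

variable {W : WeierstrassCurve ℚ} [W.IsElliptic] [W.IsGloballyMinimal] {p : ℕ} [Fact p.Prime]
  [ContinuousSMul ℤ_[p] (W.tateModule p)] {K : ZpExtension ℚ p} {hK : K.IsCyclotomic}
  {γ : absoluteGaloisGroup ℚ} {I : IwasawaH1Data W p K γ}

/-- `HasRealisedZetaFamily ↔ HasRealisedZetaFamilyBody` under ANY instances of the two (`Prop`-valued) structure facts.
[cite: Kato2004Asterisque, (8.1.3) (p. 180)] -/
theorem hasRealisedZetaFamily_iff [i₂ : Module.Free ℤ_[p] (W.tateModule p)] [i₃ : Module.Finite ℤ_[p] (W.tateModule p)] :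
    HasRealisedZetaFamily W p K hK I ↔ HasRealisedZetaFamilyBody W p K hK I := by
  have h₂ : i₂ = W.module_free_tateModule_holds p := Subsingleton.elim _ _
  have h₃ : i₃ = W.module_finite_tateModule_holds p := Subsingleton.elim _ _
  subst h₂ h₃
  exact Iff.rfl

/-- `ZetaClassPosition ↔ ZetaClassPositionBody` under ANY instances of the two (`Prop`-valued) structure facts.
[cite: Kato2004Asterisque, Thm. 12.5 (1) (p. 221)] -/
theorem zetaClassPosition_iff [i₂ : Module.Free ℤ_[p] (W.tateModule p)] [i₃ : Module.Finite ℤ_[p] (W.tateModule p)]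
    (k : ℕ) (z₁ : I.H) : ZetaClassPosition W p K hK I k z₁ ↔ ZetaClassPositionBody W p K hK I k z₁ := by
  have h₂ : i₂ = W.module_free_tateModule_holds p := Subsingleton.elim _ _
  have h₃ : i₃ = W.module_finite_tateModule_holds p := Subsingleton.elim _ _
  subst h₂ h₃
  exact Iff.rfl

variable [Module.Free ℤ_[p] (W.tateModule p)] [Module.Finite ℤ_[p] (W.tateModule p)]

/-- **An admissible class witnesses a realised family** (forget `z₀` and its position). Kernel.
[cite: Kato2004Asterisque, Lemma 13.10 (1) (p. 230)] -/
theorem AdmissibleZetaClassBody.hasRealisedZetaFamilyBody {z₀ : I.H} (h : AdmissibleZetaClassBody W p K hK I z₀) :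
    HasRealisedZetaFamilyBody W p K hK I := by
  obtain ⟨hp, N, hN, f, hf, ι, q, Λ, hq, hZ, c, d₁, a, A, d', hA, hc, hd, hdd', hR, z, x, hzeta, y, hy,
    qm, perRatio, e, u, n₁, n₂, n₃, n₄, σc, σd, σℓ, hqm, hspan, h₁, h₂, h₃, h₄, hσc, hσd, hσℓ, hper0, hper, he,
    hpos⟩ := h
  exact ⟨hp, N, hN, f, hf, ι, q, Λ, hq, hZ, c, d₁, a, A, d', hA, hc, hd, hdd', hR, z, x, hzeta, y, hy,
    qm, perRatio, e, n₁, n₂, n₃, n₄, σc, σd, σℓ, hqm, hspan, h₁, h₂, h₃, h₄, hσc, hσd, hσℓ, hper0, hper, he⟩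

/-- **Position at `k = 0` + ONE realised family ⇒ ADMISSIBLE** (instantiate the uniform position at the family's data;
`p^0 = 1`).  This is how a consumer turns the fact below into `IsAdmissibleZetaClass` once it has shown `k = 0` (or divided
`p^k` out, `of_pow_smul`). Kernel. [cite: Kato2004Asterisque, Thm. 12.5 (1) (p. 221), Lemma 13.10 (1) (p. 230)] -/
theorem ZetaClassPositionBody.admissibleZetaClassBody {z₀ : I.H} (h : ZetaClassPositionBody W p K hK I 0 z₀)
    (hR : HasRealisedZetaFamilyBody W p K hK I) : AdmissibleZetaClassBody W p K hK I z₀ := by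
  obtain ⟨hp, N, hN, f, hf, ι, q, Λ, hq, hZ, c, d₁, a, A, d', hA, hc, hd, hdd', hRm, z, x, hzeta, y, hy,
    qm, perRatio, e, n₁, n₂, n₃, n₄, σc, σd, σℓ, hqm, hspan, h₁, h₂, h₃, h₄, hσc, hσd, hσℓ, hper0, hper, he⟩ := hR
  obtain ⟨-, u, hu⟩ := h hp N hN f hf ι q Λ hq hZ c d₁ a A d' hA hc hd hdd' hRm z x hzeta y hy qm perRatio e n₁ n₂ n₃ n₄
    σc σd σℓ hqm hspan h₁ h₂ h₃ h₄ hσc hσd hσℓ hper0 hper he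
  refine ⟨hp, N, hN, f, hf, ι, q, Λ, hq, hZ, c, d₁, a, A, d', hA, hc, hd, hdd', hRm, z, x, hzeta, y, hy,
    qm, perRatio, e, u, n₁, n₂, n₃, n₄, σc, σd, σℓ, hqm, hspan, h₁, h₂, h₃, h₄, hσc, hσd, hσℓ, hper0, hper, he, ?_⟩
  simpa only [pow_zero, mul_one] using hu

/-- **The position is non-vacuously informative**: under it, a realised family forces `z₁ ≠ 0` (Thm. 12.5 (2) on the branch).
Kernel. [cite: Kato2004Asterisque, Thm. 12.5 (2) (p. 221), Prop. 13.7 (p. 227)] -/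
theorem ZetaClassPositionBody.ne_zero {k : ℕ} {z₁ : I.H} (h : ZetaClassPositionBody W p K hK I k z₁)
    (hR : HasRealisedZetaFamilyBody W p K hK I) : z₁ ≠ 0 := by
  obtain ⟨hp, N, hN, f, hf, ι, q, Λ, hq, hZ, c, d₁, a, A, d', hA, hc, hd, hdd', hRm, z, x, hzeta, y, hy,
    qm, perRatio, e, n₁, n₂, n₃, n₄, σc, σd, σℓ, hqm, hspan, h₁, h₂, h₃, h₄, hσc, hσd, hσℓ, hper0, hper, he⟩ := hR
  exact (h hp N hN f hf ι q Λ hq hZ c d₁ a A d' hA hc hd hdd' hRm z x hzeta y hy qm perRatio e n₁ n₂ n₃ n₄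
    σc σd σℓ hqm hspan h₁ h₂ h₃ h₄ hσc hσd hσℓ hper0 hper he).1

/-- **Dividing `p^k` out**: if `p^k • z₀` is in uniform position with exponent `k`, then `z₀` is in uniform position with
exponent `0` — `I.H` being `Λ`-TORSION-FREE (tree theorem `IwasawaH1Data.isTorsionFree`, here a hypothesis so that the
lemma is pure algebra) and `(p : Λ)^k` a non-zero element of the domain `Λ`.  The consumer's §13.14 step supplies
`z₁ = p^k • z₀`. Kernel. [cite: Kato2004Asterisque, §13.14 (p. 234), Thm. 12.4 (2) (p. 221)] -/
theorem ZetaClassPositionBody.of_pow_smul {k : ℕ} {z₀ : I.H}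
    (h : ZetaClassPositionBody W p K hK I k (((p : IwasawaAlgebra p) ^ k) • z₀))
    (htf : Module.IsTorsionFree (IwasawaAlgebra p) I.H) : ZetaClassPositionBody W p K hK I 0 z₀ := by
  intro hp N hN f hf ι q Λ hq hZ c d₁ a A d' hA hc hd hdd' hRm z x hzeta y hy qm perRatio e n₁ n₂ n₃ n₄ σc σd σℓ hqm
    hspan h₁ h₂ h₃ h₄ hσc hσd hσℓ hper0 hper he
  obtain ⟨hne, u, hu⟩ := h hp N hN f hf ι q Λ hq hZ c d₁ a A d' hA hc hd hdd' hRm z x hzeta y hy qm perRatio e n₁ n₂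
    n₃ n₄ σc σd σℓ hqm hspan h₁ h₂ h₃ h₄ hσc hσd hσℓ hper0 hper he
  refine ⟨fun h0 => hne (by rw [h0, smul_zero]), u, ?_⟩
  have hp0 : (p : IwasawaAlgebra p) ≠ 0 := by
    intro h0
    have h' := congr_arg PowerSeries.constantCoeff h0
    rw [map_natCast, map_zero] at h'
    exact (Fact.out : p.Prime).ne_zero (by exact_mod_cast h')
  have hpk : ((p : IwasawaAlgebra p) ^ k) ≠ 0 := pow_ne_zero _ hp0
  have hreg : IsRegular ((p : IwasawaAlgebra p) ^ k) := IsRegular.of_ne_zero hpk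
  apply hreg.smul_right_injective I.H
  dsimp only
  rw [pow_zero, mul_one, smul_smul, smul_smul, mul_comm ((p : IwasawaAlgebra p) ^ k), ← smul_smul, hu, mul_comm]

end Bridges

/-! ## §4 The named fact (Kato Thm. 12.5 (1)(2), §13.9, Lemma 13.10 (1) on the `Δ`-trivial branch under «rank ≤ 1») -/

/-- **Kato 2004, Thm. 12.5 (1)(2) with §13.9 («independent of the choices») and Lemma 13.10 (1), ON THE `Δ`-TRIVIAL
BRANCH, Thm. 12.4 (2) replaced by the hypothesis «`rank_Λ 𝐇¹_Γ(T_pW) ≤ 1`».**  For every globally minimal elliptic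
curve `W/ℚ`, every prime `p ≠ 2`, every cyclotomic `ℤ_p`-extension `K` of `ℚ` with topological generator `γ`, and
EVERY pinned Iwasawa cohomology `I : IwasawaH1Data W p K γ` (`I.H = 𝐇¹_Γ(T_pW)`) whose `Λ`-rank is `≤ 1` (the branch
form of Thm. 12.4 (2): on the pin a THEOREM from `rank_{ℤ_p} H¹(ℤ[1/p], T_pW) ≤ 1`, corollary `of_rank_integralH1_le_one`),
there are `z₁ ∈ I.H` and `k : ℕ` in UNIFORM POSITION `ZetaClassPosition W p K hK I k z₁`: for every value-pinned
`(c, d₁, a, A)`-family realised in `I.H` (with its Manin/period data), `z₁ ≠ 0` and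
`((p : Λ)^{(−e)⁺}·M̃) • z₁ = (u·(p : Λ)^{e⁺}·(p : Λ)^k) • y`, `u ∈ Λˣ` — i.e. «`z₁ = p^k·𝐳_{γ_W}` with Kato's
`Ω_W`-normalised zeta class `𝐳_{γ_W} ∈ 𝐇¹_Γ(T_pW) ⊗ ℚ`, ONE element for all families».  Printed content: Thm. 12.5 (1)
«there exists a unique `F_λ`-linear map `γ ↦ 𝐳_γ^{(p)}` [into `𝐇¹(V_{F_λ}(f)) = 𝐇¹(T) ⊗ ℚ`] having the following
property [the `exp*`-values `L_{(p)}(f, χ, r)·γ^±`]» (p. 221; membership in `𝐇¹(V)` rather than `𝐇¹(V) ⊗_Λ Q(Λ)` is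
§13.12), §13.9 «Since `𝐇¹(V_{F_λ}(f))` is a free `Λ[1/p]`-module of rank 1 (Thm. 12.4 (2)), this shows that `z_γ^{(p)}` is
independent of the choices» (p. 230 l. 8–9), Lemma 13.10 (1) (the integral `a(A)`-type class = multiplier · `z_{δ}`, p. 230),
Thm. 12.5 (2) (p. 221, via Prop. 13.7) — every input printed for ALL newforms, `p`, `λ` except Thm. 12.4 (2), used only as
«values at almost all `χ` separate elements of `𝐇¹(V) ⊗ Q(Λ)`», which on one branch of `Λ = ∏_j Λ_j` (`p` odd, (12.1.3))
follows from torsion-freeness (tree theorem) and rank `≤ 1` (the hypothesis) — module docstring «THE BRANCH READING»,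
after `E3primeAudit-g58.md` §2–§4; Kato himself: «Thm. 12.5 (1) (2) and Thm. 12.6 are proved by the same arguments in
13.9–13.13» once 12.4 is available (§15.16, p. 265).  The VALUES of Thm. 12.5 (1) are carried by the position w.r.t. the
value-pinned family (`AdmissibleZetaClass.lean`, «WHY THIS IS KATO'S ELEMENT»); Thm. 12.6's finite-index clause is NOT part
of this fact (module docstring).  WHERE THE NON-VANISHING OF THE ZETA ELEMENT ENTERS: the conjunct `z₁ ≠ 0` (given a
realised family) is Kato's (NT) «`𝐇¹_Γ(T_pW) ≠ 0`» on the branch — the one clause of Thm. 12.4 (2) that the tree does NOT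
prove (`IwasawaH1RankLeOneProofs.lean` §2, `nontrivial_iwasawaH1_of_thm12_4`; E3primeAudit-g58 §3): Prop. 13.7 / Thm. 12.5 (2)
(13.6 + Thm. 6.6 + Thm. 9.7 + Thm. 13.5, printed before «no CM», p. 227).  WEAKER than print where it differs: one branch, `γ⁺_W` and `r = 1` only, conclusion in
`𝐇¹ ⊗ ℚ` only.  Named fact; nothing asserted; no `_holds` here (size XL: Kato §13 with the explicit reciprocity law).
[cite: Kato2004Asterisque, Thm. 12.5 (1)(2) (p. 221); §13.9 (pp. 229–230, p. 230 l. 8–9); Lemma 13.10 (1) (p. 230); §13.12–13.13 (pp. 231–233); Thm. 12.4 (2) (p. 221); (12.1.3) (p. 220); §15.16 (p. 265)]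
[cite: RohrlichInventiones1984, Theorem p. 409 (generic non-vanishing, through Kato Thm. 13.5 (2))]
[cite: Manin1972, Thm. 1.6 and Cor. 3.6] [cite: BlochKato1990, §3, Prop. 3.8 and Example 3.11] -/
def exists_zetaClassPosition_of_rank_le_one : Prop :=
  ∀ (W : WeierstrassCurve ℚ) [W.IsElliptic] [W.IsGloballyMinimal] (p : ℕ) [Fact p.Prime]
    [ContinuousSMul ℤ_[p] (W.tateModule p)] (κ : ZpExtension ℚ p) (γ : absoluteGaloisGroup ℚ)
    (hκ : κ.IsCyclotomic), κ.IsTopGenerator γ → p ≠ 2 →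
      ∀ I : IwasawaH1Data W p κ γ, Module.rank (IwasawaAlgebra p) I.H ≤ 1 →
        ∃ (z₁ : I.H) (k : ℕ), ZetaClassPosition W p κ hκ I k z₁

-- TODO(general form): Thm. 12.5 (1)(2) and Thm. 12.6 for newforms of weight `k ≥ 2` with coefficients, every `γ` and
-- `1 ≤ r ≤ k − 1`, all `Δ`-branches of `O_λ⟦G_∞⟧`, with Thm. 12.4 (2) as printed (no rank hypothesis) — and the
-- finite-index clause `Z(f, T)/Z` with Kato's full `Z`.

/-! ## §5 Proved corollaries (re-shapings for the consumers; no new fact) -/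

namespace exists_zetaClassPosition_of_rank_le_one

variable {W : WeierstrassCurve ℚ} [W.IsElliptic] [W.IsGloballyMinimal] {p : ℕ} [Fact p.Prime]
  [ContinuousSMul ℤ_[p] (W.tateModule p)] {κ : ZpExtension ℚ p} {γ : absoluteGaloisGroup ℚ}

/-- **Instantiation from the base level** (the planner's «discharge `rank ≤ 1` from
`rank_le_one_of_rank_integralH1_le_one`»): under the fact, `rank_{ℤ_p} H¹(ℤ[1/p], T_pW) ≤ 1` (the tree's
`integralH1 (tateRep W p) p (κ.layerSubgroup 0)`; Summits side this is `rank_ℤ W(ℚ) = 1 ∧ Ш(W)[p^∞]` finite, i.e. GZK at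
`r_an = 1`) gives the uniform position on EVERY pin over the cyclotomic datum.
[cite: Kato2004Asterisque, Thm. 12.5 (1) (p. 221), Thm. 12.4 (2) (p. 221)] -/
theorem of_rank_integralH1_le_one (h : exists_zetaClassPosition_of_rank_le_one) (hκ : κ.IsCyclotomic)
    (hγ : κ.IsTopGenerator γ) (hp : p ≠ 2) (I : IwasawaH1Data W p κ γ)
    (hrank : Module.rank ℤ_[p] (integralH1 (tateRep W p) p (κ.layerSubgroup 0)) ≤ 1) :
    ∃ (z₁ : I.H) (k : ℕ), ZetaClassPosition W p κ hκ I k z₁ :=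
  h W p κ γ hκ hγ hp I (I.rank_le_one_of_rank_integralH1_le_one hκ hγ hrank)

/-- **From the fact to an ADMISSIBLE class, given the consumer's two inputs**: a realised family (the realisation
datum) and the divisibility `z₁ = p^k • z₀` of the fact's witness (the §13.14 step on the branch, route-side).  Then
`z₀` is an admissible Kato zeta class of the pin (`IsAdmissibleZetaClass`).
[cite: Kato2004Asterisque, Thm. 12.5 (1) (p. 221), §13.14 (p. 234), Conj. 12.10 (p. 224)] -/
theorem isAdmissibleZetaClass_of_eq_pow_smul (hκ : κ.IsCyclotomic) (hγ : κ.IsTopGenerator γ) {I : IwasawaH1Data W p κ γ}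
    {k : ℕ} {z₁ z₀ : I.H} (hpos : ZetaClassPosition W p κ hκ I k z₁)
    (hdiv : z₁ = ((p : IwasawaAlgebra p) ^ k) • z₀) (hR : HasRealisedZetaFamily W p κ hκ I) :
    IsAdmissibleZetaClass W p κ hκ I z₀ := by
  letI : Module.Free ℤ_[p] (W.tateModule p) := W.module_free_tateModule_holds p
  letI : Module.Finite ℤ_[p] (W.tateModule p) := W.module_finite_tateModule_holds p
  have hpos' : ZetaClassPositionBody W p κ hκ I k (((p : IwasawaAlgebra p) ^ k) • z₀) := by
    rw [← hdiv]; exact (zetaClassPosition_iff k z₁).mp hpos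
  exact isAdmissibleZetaClass_of_body
    ((hpos'.of_pow_smul (I.isTorsionFree hγ)).admissibleZetaClassBody ((hasRealisedZetaFamily_iff).mp hR))

/-- **In particular at `k = 0`**: if the fact's witness comes with `k = 0` and a family is realised, an admissible class
exists. [cite: Kato2004Asterisque, Thm. 12.5 (1) (p. 221), Conj. 12.10 (p. 224)] -/
theorem isAdmissibleZetaClass_of_zero (hκ : κ.IsCyclotomic) (hγ : κ.IsTopGenerator γ) {I : IwasawaH1Data W p κ γ}
    {z₀ : I.H} (hpos : ZetaClassPosition W p κ hκ I 0 z₀) (hR : HasRealisedZetaFamily W p κ hκ I) :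
    IsAdmissibleZetaClass W p κ hκ I z₀ :=
  isAdmissibleZetaClass_of_eq_pow_smul hκ hγ hpos (by rw [pow_zero, one_smul]) hR

end exists_zetaClassPosition_of_rank_le_one

/-! ## §6 The §13.14 step on the branch made KERNEL: a μ-free realised family with `e ≥ 0` in a FREE pin gives an
ADMISSIBLE class from the fact (pure `Λ`-algebra: `p` is prime in `Λ = ℤ_p⟦T⟧`, coordinates in a basis) -/

set_option backward.isDefEq.respectTransparency false in
/-- **`HasMuFreeRealisedZetaFamilyBody W p K hK I` — a realised value-pinned family (VERBATIM `HasRealisedZetaFamilyBody`)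
whose Kato multiplier is `μ`-FREE, `¬ (p : Λ) ∣ M̃` (e.g. `[a/A]⁻_f/q⁻` a `p`-adic unit and `c ≡ d₁ ≡ d′ ≡ 1 (mod A)`:
then `M̃ = n₁·c d₁(c − Ψ_c)(d₁ − Ψ_{d₁})·∏_ℓ(ℓ²Ψ_ℓ² − a_ℓ ℓ Ψ_ℓ + ε_ℓ ℓ)` has a unit coefficient — the role Thm. 13.6 + Lemma 13.10
(2) play in §13.12's «`Λ/μΛ` is `p`-torsion free»), AND whose exponent `e = v_p((Ω⁺_f/Ω_W)/(q·q⁻))` is `≥ 0`** (the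
member-dependent input: which member of the isogeny class, which normalisation of the realised classes).  A `Prop`;
a HYPOTHESIS shape for the consumer's (E2); nothing asserted.
[cite: Kato2004Asterisque, §13.12 (p. 231, "a non-zero-divisor μ of Λ such that μZ(f,T) ⊂ Z and Λ/μΛ is p-torsion free"), Lemma 13.10 (1) (p. 230), §13.14 (p. 234)]
[cite: Manin1972, Thm. 1.6 and Cor. 3.6] [cite: BlochKato1990, Prop. 3.8 (p. 354) and Example 3.11 (p. 361)] -/
def HasMuFreeRealisedZetaFamilyBody (W : WeierstrassCurve ℚ) [W.IsElliptic] [W.IsGloballyMinimal] (p : ℕ) [Fact p.Prime]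
    [ContinuousSMul ℤ_[p] (W.tateModule p)] [Module.Free ℤ_[p] (W.tateModule p)]
    [Module.Finite ℤ_[p] (W.tateModule p)] (K : ZpExtension ℚ p) (hK : K.IsCyclotomic)
    {γ : absoluteGaloisGroup ℚ} (I : IwasawaH1Data W p K γ) : Prop :=
  letI ρT := restrictedTateRep W (NumberField.Place.Completion (Sum.inr ((Rat.HeightOneSpectrum.primesEquiv (R := 𝓞 ℚ)).symm ⟨p, Fact.out⟩) : NumberField.Place ℚ)) p
  letI : ValuativeRel (NumberField.Place.Completion (Sum.inr ((Rat.HeightOneSpectrum.primesEquiv (R := 𝓞 ℚ)).symm ⟨p, Fact.out⟩) : NumberField.Place ℚ)) :=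
    inferInstanceAs (ValuativeRel (((Rat.HeightOneSpectrum.primesEquiv (R := 𝓞 ℚ)).symm ⟨p, Fact.out⟩).adicCompletion ℚ))
  letI : TopologicalSpace (NumberField.Place.Completion (Sum.inr ((Rat.HeightOneSpectrum.primesEquiv (R := 𝓞 ℚ)).symm ⟨p, Fact.out⟩) : NumberField.Place ℚ)) :=
    inferInstanceAs (TopologicalSpace (((Rat.HeightOneSpectrum.primesEquiv (R := 𝓞 ℚ)).symm ⟨p, Fact.out⟩).adicCompletion ℚ))
  haveI : IsNonarchimedeanLocalField (NumberField.Place.Completion (Sum.inr ((Rat.HeightOneSpectrum.primesEquiv (R := 𝓞 ℚ)).symm ⟨p, Fact.out⟩) : NumberField.Place ℚ)) :=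
    inferInstanceAs (IsNonarchimedeanLocalField (((Rat.HeightOneSpectrum.primesEquiv (R := 𝓞 ℚ)).symm ⟨p, Fact.out⟩).adicCompletion ℚ))
  haveI : CharZero (NumberField.Place.Completion (Sum.inr ((Rat.HeightOneSpectrum.primesEquiv (R := 𝓞 ℚ)).symm ⟨p, Fact.out⟩) : NumberField.Place ℚ)) := LocalField.charZero_adicCompletion ((Rat.HeightOneSpectrum.primesEquiv (R := 𝓞 ℚ)).symm ⟨p, Fact.out⟩)
  letI : Algebra ℚ_[p] (NumberField.Place.Completion (Sum.inr ((Rat.HeightOneSpectrum.primesEquiv (R := 𝓞 ℚ)).symm ⟨p, Fact.out⟩) : NumberField.Place ℚ)) :=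
    LocalField.adicCompletionPadicAlgebra ((Rat.HeightOneSpectrum.primesEquiv (R := 𝓞 ℚ)).symm ⟨p, Fact.out⟩) p ((natCast_mem_asIdeal_iff_eq_primesEquiv_symm _ (Fact.out : p.Prime)).mpr rfl)
  haveI : Fact (¬ IsUnit ((p : ℕ) : integerC (NumberField.Place.Completion (Sum.inr ((Rat.HeightOneSpectrum.primesEquiv (R := 𝓞 ℚ)).symm ⟨p, Fact.out⟩) : NumberField.Place ℚ)))) :=
    ⟨not_isUnit_natCast_integerC (show valuation (NumberField.Place.Completion (Sum.inr ((Rat.HeightOneSpectrum.primesEquiv (R := 𝓞 ℚ)).symm ⟨p, Fact.out⟩) : NumberField.Place ℚ)) ((p : ℕ) : (NumberField.Place.Completion (Sum.inr ((Rat.HeightOneSpectrum.primesEquiv (R := 𝓞 ℚ)).symm ⟨p, Fact.out⟩) : NumberField.Place ℚ))) < 1 from LocalField.valuation_adicCompletion_natCast_lt_one ((Rat.HeightOneSpectrum.primesEquiv (R := 𝓞 ℚ)).symm ⟨p, Fact.out⟩) p ((natCast_mem_asIdeal_iff_eq_primesEquiv_symm _ (Fact.out : p.Prime)).mpr rfl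))⟩
  haveI := isAdicComplete_integerC_natCast (show valuation (NumberField.Place.Completion (Sum.inr ((Rat.HeightOneSpectrum.primesEquiv (R := 𝓞 ℚ)).symm ⟨p, Fact.out⟩) : NumberField.Place ℚ)) ((p : ℕ) : (NumberField.Place.Completion (Sum.inr ((Rat.HeightOneSpectrum.primesEquiv (R := 𝓞 ℚ)).symm ⟨p, Fact.out⟩) : NumberField.Place ℚ))) < 1 from LocalField.valuation_adicCompletion_natCast_lt_one ((Rat.HeightOneSpectrum.primesEquiv (R := 𝓞 ℚ)).symm ⟨p, Fact.out⟩) p ((natCast_mem_asIdeal_iff_eq_primesEquiv_symm _ (Fact.out : p.Prime)).mpr rfl))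
  -- the tree's `ℚ`-algebra structure on `ℚ_v` pinned, as in `AdmissibleZetaClassBody`
  letI : Algebra ℚ (NumberField.Place.Completion (Sum.inr ((Rat.HeightOneSpectrum.primesEquiv (R := 𝓞 ℚ)).symm ⟨p, Fact.out⟩) : NumberField.Place ℚ)) := NumberField.Place.instAlgebraCompletion (Sum.inr ((Rat.HeightOneSpectrum.primesEquiv (R := 𝓞 ℚ)).symm ⟨p, Fact.out⟩) : NumberField.Place ℚ)
  ∃ (hp : p ≠ 2) (N : ℕ) (_ : NeZero N) (f : CuspForm (Gamma0 N) 2) (_ : IsNewformOf W f)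
    (ι : (n : ℕ) → (CyclotomicField n ℚ →+* ℂ)) (q : ℚ)
    (Λ : ∀ (k : ℕ) (r : Finset (HeightOneSpectrum (𝓞 ℚ))),
      H1 (tateRep W p) (cycSubgroup p k r) →ₗ[ℤ_[p]] ℚ_[p] ⊗[ℚ] CyclotomicField (cycLevel p k r) ℚ),
    -- (A0) the constant of the value law is non-zero
    q ≠ 0 ∧
    -- (A1) ∧ (A2): the value functional IS the dual exponential in a Tate-duality-normalised coordinate `d`
    (∃ d, DefinedExpStarBody W p f d ι ((q : ℚ) : ℝ) Λ ∧
      ∀ a : (NumberField.Place.Completion (Sum.inr ((Rat.HeightOneSpectrum.primesEquiv (R := 𝓞 ℚ)).symm ⟨p, Fact.out⟩) : NumberField.Place ℚ)),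
        (∃ η : contOneCocycles ρT.toTopRep, expStarCoord W (show valuation (NumberField.Place.Completion (Sum.inr ((Rat.HeightOneSpectrum.primesEquiv (R := 𝓞 ℚ)).symm ⟨p, Fact.out⟩) : NumberField.Place ℚ)) ((p : ℕ) : (NumberField.Place.Completion (Sum.inr ((Rat.HeightOneSpectrum.primesEquiv (R := 𝓞 ℚ)).symm ⟨p, Fact.out⟩) : NumberField.Place ℚ))) < 1 from LocalField.valuation_adicCompletion_natCast_lt_one ((Rat.HeightOneSpectrum.primesEquiv (R := 𝓞 ℚ)).symm ⟨p, Fact.out⟩) p ((natCast_mem_asIdeal_iff_eq_primesEquiv_symm _ (Fact.out : p.Prime)).mpr rfl)) d η = a) ↔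
          ∀ Q : (W.baseChange ℚ_[p]).toAffine.Point,
            ‖(Padic.adicCompletionEquiv (𝓞 ℚ) ⟨p, Fact.out⟩).symm
                (show ((Rat.HeightOneSpectrum.primesEquiv (R := 𝓞 ℚ)).symm ⟨p, Fact.out⟩).adicCompletion ℚ from a) * padicLogLocal W p Q‖ ≤ 1) ∧
    -- (A3) Kato's parameters with the printed guards, and THE family
    ∃ (c d₁ a : ℤ) (A : ℕ) (d' : ℤ),
      0 < A ∧ Int.gcd c (6 * p * A) = 1 ∧ Int.gcd d₁ (6 * p * N) = 1 ∧ (d₁ : ℤ) * d' ≡ 1 [ZMOD (A : ℤ)] ∧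
      ratCuspFactor f true c d₁ a A d' ≠ 0 ∧
    ∃ (z : ∀ (k : ℕ) (r : (cyclotomicLevelsRat p (badPlaces c d₁ A N)).Ideals),
        H1 (tateRep W p) ((cyclotomicLevelsRat p (badPlaces c d₁ A N)).level k r.1))
      (x : ∀ (k : ℕ) (r : (cyclotomicLevelsRat p (badPlaces c d₁ A N)).Ideals),
        CyclotomicField (cycLevel p k r.1) ℚ),
      ZetaBody W p f ι ((q : ℚ) : ℝ) Λ c d₁ a A z x ∧
    -- (A4) the Λ-adic lift INTO THE GIVEN `I` — this is the REALISATION DATUM (the classes land in `I.H`)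
    ∃ (y : I.H),
      (∀ n : ℕ, I.proj n y =
        levelToLayer W p hK hp (badPlaces c d₁ A N) n
          (z (n + 1) (cyclotomicLevelsRat p (badPlaces c d₁ A N)).idealOne)) ∧
    -- (A5′) ∧ (A6′-scalars): the Manin lattice datum, the Galois elements of the multiplier, the period ratio and `e`
    ∃ (qm perRatio : ℚ) (e : ℤ) (n₁ n₂ n₃ n₄ : ℤ) (σc σd : absoluteGaloisGroup ℚ)
      (σℓ : ℕ → absoluteGaloisGroup ℚ),
      0 < qm ∧ AddSubgroup.closure (Set.range (ratMinusSymbol f)) = AddSubgroup.zmultiples qm ∧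
      ratMinusSymbol f ((a : ℚ) / A) = n₁ * qm ∧ ratMinusSymbol f ((a * c : ℚ) / A) = n₂ * qm ∧
      ratMinusSymbol f ((a * d' : ℚ) / A) = n₃ * qm ∧ ratMinusSymbol f ((a * c * d' : ℚ) / A) = n₄ * qm ∧
      ((GaloisRep.cyclotomicCharacter ℚ p σc : ℤ_[p]ˣ) : ℤ_[p]) = c ∧
      ((GaloisRep.cyclotomicCharacter ℚ p σd : ℤ_[p]ˣ) : ℤ_[p]) = d₁ ∧
      (∀ ℓ ∈ A.primeFactors.erase p, ((GaloisRep.cyclotomicCharacter ℚ p (σℓ ℓ) : ℤ_[p]ˣ) : ℤ_[p]) = ℓ) ∧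
      perRatio ≠ 0 ∧ plusPeriod f = ((perRatio : ℚ) : ℝ) * W.realPeriodRat ∧
      padicValRat p (perRatio / (q * qm)) = e ∧
      -- (μ-FREE ∧ e ≥ 0): the multiplier is NOT divisible by `p` in `Λ`, and the period/constant exponent is non-negative
      ¬ ((p : IwasawaAlgebra p) ∣
          katoMultiplier p c d₁ n₁ n₂ n₃ n₄
            ((IwasawaCharacter.Psi p ℤ_[p] K σc : (PowerSeries ℤ_[p])ˣ) : IwasawaAlgebra p)
            ((IwasawaCharacter.Psi p ℤ_[p] K σd : (PowerSeries ℤ_[p])ˣ) : IwasawaAlgebra p)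
            (A.primeFactors.erase p) (fun ℓ => W.LFunction ℓ) (fun ℓ => if ℓ ∣ N then 0 else 1)
            (fun ℓ => ((IwasawaCharacter.Psi p ℤ_[p] K (σℓ ℓ) : (PowerSeries ℤ_[p])ˣ) : IwasawaAlgebra p))) ∧
      0 ≤ e

/-- `HasMuFreeRealisedZetaFamily`, CLOSED (structure facts of `T_pW` by the tree theorems).
[cite: Kato2004Asterisque, §13.12 (p. 231), §13.14 (p. 234)] -/
def HasMuFreeRealisedZetaFamily (W : WeierstrassCurve ℚ) [W.IsElliptic] [W.IsGloballyMinimal] (p : ℕ) [Fact p.Prime]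
    [ContinuousSMul ℤ_[p] (W.tateModule p)] (K : ZpExtension ℚ p) (hK : K.IsCyclotomic)
    {γ : absoluteGaloisGroup ℚ} (I : IwasawaH1Data W p K γ) : Prop :=
  letI : Module.Free ℤ_[p] (W.tateModule p) := W.module_free_tateModule_holds p
  letI : Module.Finite ℤ_[p] (W.tateModule p) := W.module_finite_tateModule_holds p
  HasMuFreeRealisedZetaFamilyBody W p K hK I

section MuFree

variable {W : WeierstrassCurve ℚ} [W.IsElliptic] [W.IsGloballyMinimal] {p : ℕ} [Fact p.Prime]
  [ContinuousSMul ℤ_[p] (W.tateModule p)] {K : ZpExtension ℚ p} {hK : K.IsCyclotomic}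
  {γ : absoluteGaloisGroup ℚ} {I : IwasawaH1Data W p K γ}

/-- `HasMuFreeRealisedZetaFamily ↔ HasMuFreeRealisedZetaFamilyBody` under any instances of the structure facts.
[cite: Kato2004Asterisque, §13.12 (p. 231)] -/
theorem hasMuFreeRealisedZetaFamily_iff [i₂ : Module.Free ℤ_[p] (W.tateModule p)]
    [i₃ : Module.Finite ℤ_[p] (W.tateModule p)] :
    HasMuFreeRealisedZetaFamily W p K hK I ↔ HasMuFreeRealisedZetaFamilyBody W p K hK I := by
  have h₂ : i₂ = W.module_free_tateModule_holds p := Subsingleton.elim _ _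
  have h₃ : i₃ = W.module_finite_tateModule_holds p := Subsingleton.elim _ _
  subst h₂ h₃
  exact Iff.rfl

/-- Forget the two extra clauses. Kernel. [cite: Kato2004Asterisque, §13.12 (p. 231)] -/
theorem HasMuFreeRealisedZetaFamilyBody.hasRealisedZetaFamilyBody [Module.Free ℤ_[p] (W.tateModule p)]
    [Module.Finite ℤ_[p] (W.tateModule p)] (h : HasMuFreeRealisedZetaFamilyBody W p K hK I) :
    HasRealisedZetaFamilyBody W p K hK I := by
  obtain ⟨hp, N, hN, f, hf, ι, q, Λ, hq, hZ, c, d₁, a, A, d', hA, hc, hd, hdd', hR, z, x, hzeta, y, hy,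
    qm, perRatio, e, n₁, n₂, n₃, n₄, σc, σd, σℓ, hqm, hspan, h₁, h₂, h₃, h₄, hσc, hσd, hσℓ, hper0, hper, he, -, -⟩ := h
  exact ⟨hp, N, hN, f, hf, ι, q, Λ, hq, hZ, c, d₁, a, A, d', hA, hc, hd, hdd', hR, z, x, hzeta, y, hy,
    qm, perRatio, e, n₁, n₂, n₃, n₄, σc, σd, σℓ, hqm, hspan, h₁, h₂, h₃, h₄, hσc, hσd, hσℓ, hper0, hper, he⟩

/-- `p` is a prime element of `Λ = ℤ_p⟦T⟧` (as the natural-number cast; tree `IwasawaAlgebra.prime_C`). [cite: Washington1997, §13.1] -/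
theorem prime_natCast_iwasawaAlgebra (p : ℕ) [Fact p.Prime] : Prime (p : IwasawaAlgebra p) := by
  have h := IwasawaAlgebra.prime_C p
  rwa [map_natCast] at h

/-- **The §13.14 step as pure `Λ`-algebra**: in a FREE `Λ`-module, if `M̃ • z₁ = (c·p^k) • y` with `¬ p ∣ M̃`, then
`z₁ = p^k • z₀` for some `z₀` (coordinates in a basis; `p` prime in the UFD `Λ`: `p^k ∣ M̃·x ⇒ p^k ∣ x`).  Kato: «Since
`𝐇¹(T)` is a free `Λ`-module … this means `Z(f, T) ⊂ 𝐇¹(T)`» (p. 234). Kernel.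
[cite: Kato2004Asterisque, §13.14 (p. 234 l. 23–29)] -/
theorem exists_eq_pow_smul_of_free {M : Type*} [AddCommGroup M] [Module (IwasawaAlgebra p) M]
    [Module.Free (IwasawaAlgebra p) M] {Mt c : IwasawaAlgebra p} {z₁ y : M} (k : ℕ)
    (hMt : ¬ (p : IwasawaAlgebra p) ∣ Mt) (h : Mt • z₁ = (c * (p : IwasawaAlgebra p) ^ k) • y) :
    ∃ z₀ : M, z₁ = ((p : IwasawaAlgebra p) ^ k) • z₀ := by
  classical
  let b := Module.Free.chooseBasis (IwasawaAlgebra p) M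
  have hprime : Prime (p : IwasawaAlgebra p) := prime_natCast_iwasawaAlgebra p
  have hdvd : ∀ i, ((p : IwasawaAlgebra p) ^ k) ∣ b.repr z₁ i := by
    intro i
    have hi := congrArg (fun m => b.repr m i) h
    simp only [map_smul, Finsupp.smul_apply, smul_eq_mul] at hi
    refine hprime.pow_dvd_of_dvd_mul_left k hMt ?_
    exact ⟨c * b.repr y i, by rw [hi]; ring⟩
  let g : IwasawaAlgebra p → IwasawaAlgebra p := fun x =>
    if hx : x = 0 then 0 else if hd : ((p : IwasawaAlgebra p) ^ k) ∣ x then hd.choose else 0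
  have hg0 : g 0 = 0 := by simp [g]
  have hg : ∀ i, ((p : IwasawaAlgebra p) ^ k) * g (b.repr z₁ i) = b.repr z₁ i := by
    intro i
    by_cases hx : b.repr z₁ i = 0
    · simp [g, hx]
    · simp only [g, hx, dite_false, hdvd i, dite_true]
      exact (hdvd i).choose_spec.symm
  refine ⟨b.repr.symm (Finsupp.mapRange g hg0 (b.repr z₁)), ?_⟩
  apply b.repr.injective
  rw [map_smul, LinearEquiv.apply_symm_apply]
  refine Finsupp.ext fun i => ?_
  simp only [Finsupp.smul_apply, Finsupp.mapRange_apply, smul_eq_mul]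
  exact (hg i).symm

/-- **A μ-free realised family with `e ≥ 0` in a FREE pin divides `p^k` out of the uniform position**: from
`ZetaClassPositionBody … k z₁`, `HasMuFreeRealisedZetaFamilyBody` and `Module.Free Λ I.H` (kernel lemma
`IwasawaH1Data.moduleFree_of_torsionBy_eq_bot` when `W(ℚ)[p] = 0`), `z₁ = p^k • z₀` for some `z₀` — §13.14 on the
branch. Kernel. [cite: Kato2004Asterisque, §13.14 (p. 234), §13.12 (p. 231)] -/
theorem ZetaClassPositionBody.exists_eq_pow_smul [Module.Free ℤ_[p] (W.tateModule p)]
    [Module.Finite ℤ_[p] (W.tateModule p)] {k : ℕ} {z₁ : I.H} (h : ZetaClassPositionBody W p K hK I k z₁)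
    (hR : HasMuFreeRealisedZetaFamilyBody W p K hK I) [Module.Free (IwasawaAlgebra p) I.H] :
    ∃ z₀ : I.H, z₁ = ((p : IwasawaAlgebra p) ^ k) • z₀ := by
  obtain ⟨hp, N, hN, f, hf, ι, q, Λ, hq, hZ, c, d₁, a, A, d', hA, hc, hd, hdd', hRm, z, x, hzeta, y, hy,
    qm, perRatio, e, n₁, n₂, n₃, n₄, σc, σd, σℓ, hqm, hspan, h₁, h₂, h₃, h₄, hσc, hσd, hσℓ, hper0, hper, he, hμ, he0⟩ := hR
  obtain ⟨-, u, hu⟩ := h hp N hN f hf ι q Λ hq hZ c d₁ a A d' hA hc hd hdd' hRm z x hzeta y hy qm perRatio e n₁ n₂ n₃ n₄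
    σc σd σℓ hqm hspan h₁ h₂ h₃ h₄ hσc hσd hσℓ hper0 hper he
  have hneg : (-e).toNat = 0 := Int.toNat_eq_zero.mpr (neg_nonpos.mpr he0)
  rw [hneg, pow_zero, one_mul] at hu
  exact exists_eq_pow_smul_of_free k hμ hu

end MuFree

namespace exists_zetaClassPosition_of_rank_le_one

variable {W : WeierstrassCurve ℚ} [W.IsElliptic] [W.IsGloballyMinimal] {p : ℕ} [Fact p.Prime]
  [ContinuousSMul ℤ_[p] (W.tateModule p)] {κ : ZpExtension ℚ p} {γ : absoluteGaloisGroup ℚ}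

/-- **THE CONSUMER'S PIPELINE, CLOSED UP TO ITS TWO KERNEL INPUTS**: under the fact, a pin `I` of `Λ`-rank `≤ 1` which
is `Λ`-FREE and carries a μ-FREE realised value-pinned family with `e ≥ 0` has an ADMISSIBLE Kato zeta class
(`IsAdmissibleZetaClass`).  (At `W′ ∈ 𝒞₇`, `p = 7`: rank `≤ 1` from GZK by the tree, freeness by the kernel lemma at
`W′(ℚ)[7] = 0`, the family by (E2) — road R2's existence conjunct.)  Proof: fact ⇒ uniform position `(z₁, k)`;
`exists_eq_pow_smul` ⇒ `z₁ = p^k • z₀`; `isAdmissibleZetaClass_of_eq_pow_smul`.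
[cite: Kato2004Asterisque, Thm. 12.5 (1) (p. 221), §13.12 (p. 231), §13.14 (p. 234), Conj. 12.10 (p. 224)] -/
theorem exists_isAdmissibleZetaClass_of_muFree (h : exists_zetaClassPosition_of_rank_le_one) (hκ : κ.IsCyclotomic)
    (hγ : κ.IsTopGenerator γ) (hp : p ≠ 2) (I : IwasawaH1Data W p κ γ)
    (hrank : Module.rank (IwasawaAlgebra p) I.H ≤ 1) [Module.Free (IwasawaAlgebra p) I.H]
    (hR : HasMuFreeRealisedZetaFamily W p κ hκ I) : ∃ z₀ : I.H, IsAdmissibleZetaClass W p κ hκ I z₀ := by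
  letI : Module.Free ℤ_[p] (W.tateModule p) := W.module_free_tateModule_holds p
  letI : Module.Finite ℤ_[p] (W.tateModule p) := W.module_finite_tateModule_holds p
  obtain ⟨z₁, k, hpos⟩ := h W p κ γ hκ hγ hp I hrank
  have hRb : HasMuFreeRealisedZetaFamilyBody W p κ hκ I := (hasMuFreeRealisedZetaFamily_iff).mp hR
  obtain ⟨z₀, hz₀⟩ := ((zetaClassPosition_iff k z₁).mp hpos).exists_eq_pow_smul hRb
  exact ⟨z₀, isAdmissibleZetaClass_of_eq_pow_smul hκ hγ hpos hz₀
    ((hasRealisedZetaFamily_iff).mpr hRb.hasRealisedZetaFamilyBody)⟩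

/-- **Base-level form of the pipeline** (`rank_{ℤ_p} H¹(ℤ[1/p], T_pW) ≤ 1` instead of the `Λ`-rank).
[cite: Kato2004Asterisque, Thm. 12.5 (1) (p. 221), §13.14 (p. 234)] -/
theorem exists_isAdmissibleZetaClass_of_muFree_of_rank_integralH1_le_one (h : exists_zetaClassPosition_of_rank_le_one)
    (hκ : κ.IsCyclotomic) (hγ : κ.IsTopGenerator γ) (hp : p ≠ 2) (I : IwasawaH1Data W p κ γ)
    (hrank : Module.rank ℤ_[p] (integralH1 (tateRep W p) p (κ.layerSubgroup 0)) ≤ 1)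
    [Module.Free (IwasawaAlgebra p) I.H] (hR : HasMuFreeRealisedZetaFamily W p κ hκ I) :
    ∃ z₀ : I.H, IsAdmissibleZetaClass W p κ hκ I z₀ :=
  h.exists_isAdmissibleZetaClass_of_muFree hκ hγ hp I (I.rank_le_one_of_rank_integralH1_le_one hκ hγ hrank) hR

end exists_zetaClassPosition_of_rank_le_one

end Literature.NumberTheory.EllipticCurves.Kato2004

end
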